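import Mathlib
import Literature.Computability.AlgebraicComplexity.PermanentIrreducible

/-!
# Stub `stub_coeffGraphSubst` of crux `ChowBorderDepth3.ChowBorderBound`
# (stmt-ValiantsHypothesis-5936), line `registered`

Stub Q of the top-fan-in rungs: replace the pivot entries `X_p`, `p ∈ P`, of the generic
`n × n` matrix `(X_{r c})` by ARBITRARY polynomials `g p` (substitution `φ`), and let `σ` be a
permutation avoiding `P` (cells of `σ` are `(σ i, i)`) together with a column ranking `rk` such
that every pivot `(r, c) ∈ P` satisfies `rk c < rk (σ⁻¹ r)`.  Then the permutation monomial
`X^{μ_σ} = Π_i X_{(σ i, i)}` has coefficient exactly `1` in `φ(per_n)`.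

## Proof

`φ(per_n) = Σ_τ Π_i φ (τ i, i)`.  The `σ`-term is `X^{μ_σ}` itself (no cell of `σ` is a pivot).
For `τ ≠ σ`: every non-pivot cell `(τ i, i)` contributes the factor `X_{(τ i, i)}`, so if
`X^{μ_σ}` occurs in the `τ`-term then `μ_σ (τ i, i) ≥ 1`, i.e. `τ i = σ i`, for every such `i`.
Hence `τ = σ` off the (non-empty) set `I` of columns where `τ` meets `P`.  Take `i₀ ∈ I` with
`rk i₀` maximal and put `i₁ := σ⁻¹ (τ i₀)`; the pivot `(τ i₀, i₀)` gives `rk i₀ < rk i₁`.  If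
`i₁ ∉ I` then `τ i₁ = σ i₁ = τ i₀`, so `i₁ = i₀ ∈ I`; thus `i₁ ∈ I` and `rk i₁ ≤ rk i₀`,
absurd.  So only the `σ`-term contributes, with coefficient `1`.
-/

noncomputable section

-- `Summit.ValiantsHypothesis.ValiantsHypothesis.…` is the tree's mandated single-conjunct layout
-- (Sub = Summit), so the duplicated namespace component is intended.
set_option linter.dupNamespace false

namespace Summit.ValiantsHypothesis.ValiantsHypothesis.Theorems.ChowBorderBound.CoeffGraphSubst

open MvPolynomial Literature.Computability.AlgebraicComplexity

/-- Substituting into the generic permanent: `aeval f per = Σ_τ Π_i f (τ i, i)`. [folklore] -/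
theorem aeval_perPoly_eq_sum {ι R A : Type*} [Fintype ι] [DecidableEq ι] [CommSemiring R]
    [CommSemiring A] [Algebra R A] (f : ι × ι → A) :
    aeval f (perPoly ι R) = ∑ τ : Equiv.Perm ι, ∏ i, f (τ i, i) := by
  rw [perPoly_eq_sum_monomial, map_sum]
  refine Finset.sum_congr rfl fun τ _ => ?_
  rw [permMonomial, monomial_sum_one, map_prod]
  refine Finset.prod_congr rfl fun i _ => ?_
  exact aeval_X f (τ i, i)

variable {n : ℕ} {P : Finset (Fin n × Fin n)}
  {φ : Fin n × Fin n → MvPolynomial (Fin n × Fin n) ℂ}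

/-- If `φ` fixes the non-pivot variables and `σ` avoids the pivots, the `σ`-term of `φ(per)` is
the permutation monomial `X^{μ_σ}`. [folklore] -/
theorem prod_eq_monomial_permMonomial (hφ : ∀ v, v ∉ P → φ v = X v) {σ : Equiv.Perm (Fin n)}
    (hσ : ∀ i : Fin n, (σ i, i) ∉ P) :
    ∏ i, φ (σ i, i) = monomial (permMonomial σ) 1 := by
  rw [permMonomial, monomial_sum_one]
  refine Finset.prod_congr rfl fun i _ => ?_
  rw [hφ _ (hσ i)]
  rfl

/-- If `φ` fixes the non-pivot variables and `X^{μ_σ}` occurs in the `τ`-term of `φ(per)`, then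
`τ` agrees with `σ` at every column whose `τ`-cell is not a pivot. [folklore] -/
theorem apply_eq_of_coeff_prod_ne_zero (hφ : ∀ v, v ∉ P → φ v = X v)
    {σ τ : Equiv.Perm (Fin n)} (h : coeff (permMonomial σ) (∏ i, φ (τ i, i)) ≠ 0)
    {i : Fin n} (hi : (τ i, i) ∉ P) : τ i = σ i := by
  by_contra hne
  apply h
  rw [← Finset.mul_prod_erase Finset.univ (fun j => φ (τ j, j)) (Finset.mem_univ i),
    hφ _ hi, coeff_X_mul', if_neg]
  rw [Finsupp.mem_support_iff, permMonomial_apply, not_not]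
  exact if_neg fun h' => hne h'.symm

/-- Combinatorial core: if every pivot `(r, c)` has `rk c < rk (σ⁻¹ r)` and `τ` agrees with `σ`
off the columns where `τ` meets the pivots, then `τ = σ` (a column of maximal rank where `τ`
meets a pivot cannot exist). [folklore] -/
theorem perm_eq_of_apply_eq {σ τ : Equiv.Perm (Fin n)} {rk : Fin n → ℕ}
    (hlt : ∀ p ∈ P, rk p.2 < rk (σ.symm p.1)) (hagree : ∀ i, (τ i, i) ∉ P → τ i = σ i) :
    τ = σ := by
  suffices hfree : ∀ i, (τ i, i) ∉ P from Equiv.ext fun i => hagree i (hfree i)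
  intro i hi
  obtain ⟨i₀, hi₀, hmax⟩ := (Finset.univ.filter fun j => (τ j, j) ∈ P).exists_max_image rk
    ⟨i, Finset.mem_filter.2 ⟨Finset.mem_univ _, hi⟩⟩
  have hi₀P : (τ i₀, i₀) ∈ P := (Finset.mem_filter.1 hi₀).2
  have hlt₀ : rk i₀ < rk (σ.symm (τ i₀)) := hlt _ hi₀P
  have hi₁P : (τ (σ.symm (τ i₀)), σ.symm (τ i₀)) ∈ P := by
    by_contra hnot
    have h₁ : τ (σ.symm (τ i₀)) = τ i₀ := (hagree _ hnot).trans (σ.apply_symm_apply _)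
    rw [τ.injective h₁] at hnot
    exact hnot hi₀P
  exact absurd (hmax _ (Finset.mem_filter.2 ⟨Finset.mem_univ _, hi₁P⟩)) (not_le.2 hlt₀)

/-- The coefficient of `X^{μ_σ}` in `φ(per_n)` is `1` whenever `φ` fixes the non-pivot variables,
`σ` avoids the pivots and the column ranking `rk` is compatible with `σ`. [folklore] -/
theorem coeff_permMonomial_aeval_perPoly (hφ : ∀ v, v ∉ P → φ v = X v)
    {σ : Equiv.Perm (Fin n)} {rk : Fin n → ℕ} (hσ : ∀ i : Fin n, (σ i, i) ∉ P)
    (hlt : ∀ p ∈ P, rk p.2 < rk (σ.symm p.1)) :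
    coeff (permMonomial σ) (aeval φ (perPoly (Fin n) ℂ)) = 1 := by
  rw [aeval_perPoly_eq_sum, coeff_sum, Finset.sum_eq_single σ]
  · rw [prod_eq_monomial_permMonomial hφ hσ, coeff_monomial, if_pos rfl]
  · intro τ _ hτ
    by_contra h
    exact hτ (perm_eq_of_apply_eq hlt fun i hi => apply_eq_of_coeff_prod_ne_zero hφ h hi)
  · intro h
    exact absurd (Finset.mem_univ σ) h

/-- **Stub `stub_coeffGraphSubst`** (registered stub Q of crux stmt-ValiantsHypothesis-5936, line
`registered`): after replacing the pivot entries `X_p`, `p ∈ P`, of the generic matrix by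
arbitrary polynomials `g p`, the monomial `Π_i X_{(σ i, i)}` of a pivot-avoiding permutation `σ`
with a compatible column ranking has coefficient exactly `1` in the permanent. -/
theorem stub_coeffGraphSubst :
    ∀ (n : ℕ) (P : Finset (Fin n × Fin n))
    (g : Fin n × Fin n → MvPolynomial (Fin n × Fin n) ℂ) (σ : Equiv.Perm (Fin n))
    (rk : Fin n → ℕ), Function.Injective rk → (∀ i : Fin n, (σ i, i) ∉ P) →
    (∀ p ∈ P, rk p.2 < rk (σ.symm p.1)) →
    MvPolynomial.coeff (∑ i : Fin n, Finsupp.single (σ i, i) (1 : ℕ))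
      (MvPolynomial.aeval
        (fun v : Fin n × Fin n =>
          if v ∈ P then g v else (MvPolynomial.X v : MvPolynomial (Fin n × Fin n) ℂ))
        (Literature.Computability.AlgebraicComplexity.perPoly (Fin n) ℂ)) = 1 := by
  intro n P g σ rk _ hσ hlt
  exact coeff_permMonomial_aeval_perPoly (fun v hv => if_neg hv) hσ hlt

end Summit.ValiantsHypothesis.ValiantsHypothesis.Theorems.ChowBorderBound.CoeffGraphSubst

end
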